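import Mathlib.CategoryTheory.Galois.Equivalence
import Literature.AnabelianGeometry.Anabelioids.BasicProofs

/-!
# Galois categories have finite colimits

[SGA1, Exp. V §4–5] / Mochizuki, *The geometry of anabelioids*, Publ. RIMS **40** (2004), §1.1
p. 9 [cite: MochizukiGeoAn2004, §1.1 p.9]: a connected anabelioid (Galois category) is equivalent to
the category `B(G)` of finite sets with continuous action of a profinite group, "a rather special
kind of topos"; in particular it has all finite colimits (not only the finite coproducts and
quotients by finite groups of axioms (G2)).  Mathlib records the equivalence
`functorToContAction F : C ≌ ContAction FintypeCat (Aut F)` but not this consequence; we derive it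
from the closure of continuous finite `Aut F`-sets under finite colimits in `Action FintypeCat (Aut F)`
(`isClosedUnderColimitsOfShape_isContinuous`, `BasicProofs.lean`).  Used for the exactness of
pull-back functors between the anabelioids `B(𝒢)` of semi-graphs of anabelioids ([SemiAnbd]
Rmk. 2.11.1).  Proof-only.
-/

namespace Literature.AnabelianGeometry.Anabelioids

open CategoryTheory CategoryTheory.Limits CategoryTheory.PreGaloisCategory
open scoped FintypeCatDiscrete

universe u₂ u₁

variable (C : Type u₁) [Category.{u₂} C] [GaloisCategory C]

/-- A Galois category has colimits of every finite shape (transport along Grothendieck's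
equivalence `C ≌ ContAction FintypeCat (Aut F)` with finite continuous `Aut F`-sets, which are closed
under finite colimits among all finite `Aut F`-sets). [cite: MochizukiGeoAn2004, §1.1 p.9] -/
theorem hasColimitsOfShape_of_galoisCategory (J : Type) [SmallCategory J] [FinCategory J] :
    HasColimitsOfShape J C := by
  let F : C ⥤ FintypeCat.{max u₁ u₂} :=
    GaloisCategory.getFiberFunctor C ⋙ FintypeCat.uSwitch.{u₂, max u₁ u₂}
  letI : FiberFunctor F := FiberFunctor.comp_right _
  haveI : ObjectProperty.IsClosedUnderColimitsOfShape
      (Action.IsContinuous (V := FintypeCat.{max u₁ u₂}) (G := Aut F)) J :=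
    isClosedUnderColimitsOfShape_isContinuous J
  haveI : HasColimitsOfShape J (ContAction FintypeCat.{max u₁ u₂} (Aut F)) := inferInstance
  exact Adjunction.hasColimitsOfShape_of_equivalence (functorToContAction F)

/-- A Galois category has finite colimits. [cite: MochizukiGeoAn2004, §1.1 p.9] -/
theorem hasFiniteColimits_of_galoisCategory : HasFiniteColimits C :=
  ⟨fun J _ _ => hasColimitsOfShape_of_galoisCategory C J⟩

end Literature.AnabelianGeometry.Anabelioids
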